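import Mathlib
import Literature.NumberTheory.LFunctions.RiemannXi
import Literature.Analysis.Complex.JensenLaguerreFlow
import Literature.Analysis.Complex.HutchinsonMultiplier
import Literature.Analysis.Complex.JensenPolynomialHyperbolicity
import Summits.RiemannHypothesis.RiemannHypothesis.Theorems.Splittings.JensenCountMonotonicity
import Summits.RiemannHypothesis.RiemannHypothesis.Theorems.Splittings.JensenLaguerreFactorial
import Summits.RiemannHypothesis.RiemannHypothesis.Theorems.Splittings.JenDeflation
import Summits.RiemannHypothesis.RiemannHypothesis.Theorems.Splittings.JensenBirthBand
import HarnessLib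

/-!
# rh-split-jen-neg g15 — OBJECT G15-4 (rider R2/R3): TOP-CRITERION COLLAPSE, EXTENSION IDENTITY, REVERSAL DUALITY,
# TOWER CRITERION, COUNT FORM (v2 = TowerCriterion.lean 71be90871416eaf4 + insert-only hunks: import l.9, §6;
# §§1–3 = TowerCollapse.lean 7c28921312e0f91f verbatim under the namespace `RhSplitJenNegG15.TowerCriterion`)
# for polynomial data `γ_k = k!·P_k` (tree `JensenLaguerreFactorial.dataOf`).  RH-free, class level.

HONEST LABEL: «SPLITTING SEARCH over kernel-typed RH-EQUIVALENCES; a splitting A ∧ B ⟹ RH is CONDITIONAL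
bookkeeping unless A and B are both proved; nothing here bears on the truth of RH.»

For a real polynomial `P` of degree `m ≥ 2` with data `γ = dataOf P`:

* §1 `eval_jensenPoly_dataOf_three` : the top cell `J^{3,m-2}_γ` is the quadratic `3γ_m x² + 3γ_{m-1} x + γ_{m-2}`
  (since `γ_{m+1} = 0`); `not_splits_jensenPoly_dataOf_three` : it is NOT hyperbolic under the TOP CRITERION
  `3γ_{m-1}² < 4γ_m γ_{m-2}` (the card's last-row criterion, ADD.15 R4 (ii), there PENCIL).
* §2 `not_splits_of_topCriterion` (**TOP-CRITERION COLLAPSE**): under the top criterion EVERY row `n ≤ m-2` is already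
  non-hyperbolic at degree `m-n+1`, i.e. is born at or before one step past its full degree — the `m-1` "born at δ(n)"
  halves of a saturated staircase follow from ONE inequality, by the tree's shift lemma
  `JenDeflation.splits_jensenPoly_shift_of_succ` (`J^{d+1,n}` hyperbolic ⇒ `J^{d,n+1}` hyperbolic) iterated down the
  anti-diagonal `d + n = m + 1`.
* §3 `dataOf_derivative`, `jensenPoly_dataOf_derivative` (**EXTENSION IDENTITY**): the rows `n+1` of the datum of `R` are
  the rows `n` of the datum of `R'` — so the Jensen grid of an antiderivative `c + ∫P` is the grid of `P` shifted up by
  one row plus ONE new bottom row; a saturated tower of degree `m+1` is exactly an antiderivative of a saturated tower of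
  degree `m` whose new row `0` is hyperbolic at degree `m+1` (its non-hyperbolicity at `m+2` being automatic by §2 / T2).
* §4 `reflect_jensenPoly` (**REVERSAL DUALITY**, general data): `reflect d (J^{d,n}_γ) = J^{d,0}_a` with
  `a_i := γ_{n+d-i}` — a row-`n` cell at degree `d` is the REVERSAL of the row-`0` cell at degree `d` of the reversed
  window of the data; with the tree's `PolyaSchur.splits_reflect`, `splits_jensenPoly_iff_reflect`: the two cells are
  hyperbolic together.
* §5 `saturated_of_criterion` (**TOWER CRITERION, ⟸**): for `P` of degree `m ≥ 2` with the top criterion, if the row-`0`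
  Jensen polynomials `J^{r,0}_a` (`a_i = γ_{m-i}`, `2 ≤ r ≤ m`) are all hyperbolic then EVERY row `n ≤ m-2` of the grid of
  `γ = dataOf P` is hyperbolic at its full degree `m-n` and non-hyperbolic at `m-n+1` — the exactly saturated staircase
  `δ(n) = m-n+1` of the card's towers (ADD.15 R4, ADD.16 R2 (2)), reduced to ONE inequality and ONE family of row-`0` cells.
* §6 `nonrealRootCount_row_eq_rowZero_rev`, `nonrealRootCount_rowZero_rev_le` (**COUNT FORM**, v2, uses the tree's
  `JensenCountMonotonicity.nonrealRootCount_reflect` and `JensenBirthBand.nonrealRootCount_jensenPoly_dataOf_le_top`):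
  `N(J^{m-n,n}_γ) = N(J^{m-n,0}_a)` and `N(J^{r,0}_a) ≤ N(P)` for `r ≤ m` — the first step of the card's J₁-tower theorem
  (R2 (5a): `N(A_r) ≤ N(P_m) = 2`) as a kernel fact.
-/

open Polynomial

namespace RhSplitJenNegG15.TowerCriterion

open Literature.NumberTheory.LFunctions
open Summit.RiemannHypothesis.RiemannHypothesis.Theorems.Splittings
open Summit.RiemannHypothesis.RiemannHypothesis.Theorems.Splittings.JensenLaguerreFactorial (dataOf)
open Summit.RiemannHypothesis.RiemannHypothesis.Theorems.Splittings.JensenCountMonotonicity (coeff_jensenPoly')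

/-! ## §1 The top cell is a quadratic -/

/-- `γ_k = 0` above the degree. -/
theorem dataOf_eq_zero_of_lt (P : ℝ[X]) {k : ℕ} (hk : P.natDegree < k) : dataOf P k = 0 := by
  unfold dataOf
  rw [coeff_eq_zero_of_natDegree_lt hk, mul_zero]

/-- `γ_m ≠ 0` at the degree (for `P ≠ 0`). -/
theorem dataOf_natDegree_ne_zero (P : ℝ[X]) (hP : P ≠ 0) : dataOf P P.natDegree ≠ 0 := by
  unfold dataOf
  exact mul_ne_zero (by positivity) (leadingCoeff_ne_zero.2 hP)

/-- The top cell `J^{3,m-2}_γ` evaluates as the quadratic `3γ_m x² + 3γ_{m-1} x + γ_{m-2}`. -/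
theorem eval_jensenPoly_dataOf_three (P : ℝ[X]) {m : ℕ} (hm : P.natDegree = m) (h2 : 2 ≤ m) (x : ℝ) :
    (jensenPoly (dataOf P) 3 (m - 2)).eval x
      = 3 * dataOf P m * (x * x) + 3 * dataOf P (m - 1) * x + dataOf P (m - 2) := by
  have hlt : (jensenPoly (dataOf P) 3 (m - 2)).natDegree < 4 :=
    lt_of_le_of_lt (natDegree_jensenPoly_le _ 3 (m - 2)) (by norm_num)
  rw [eval_eq_sum_range' hlt]
  simp only [Finset.sum_range_succ, Finset.sum_range_zero, coeff_jensenPoly']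
  have e1 : m - 2 + 1 = m - 1 := by omega
  have e2 : m - 2 + 2 = m := by omega
  have e3 : dataOf P (m - 2 + 3) = 0 := dataOf_eq_zero_of_lt P (by omega)
  rw [e1, e2, e3]
  have c0 : ((Nat.choose 3 0 : ℕ) : ℝ) = 1 := by norm_num
  have c1 : ((Nat.choose 3 1 : ℕ) : ℝ) = 3 := by norm_num
  have c2 : ((Nat.choose 3 2 : ℕ) : ℝ) = 3 := by exact_mod_cast (show Nat.choose 3 2 = 3 by decide)
  rw [c0, c1, c2]
  ring

/-- Under the TOP CRITERION `3γ_{m-1}² < 4γ_m γ_{m-2}` the top cell `J^{3,m-2}_γ` has no real root … -/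
theorem eval_jensenPoly_dataOf_three_ne_zero (P : ℝ[X]) {m : ℕ} (hm : P.natDegree = m) (h2 : 2 ≤ m)
    (htop : 3 * dataOf P (m - 1) ^ 2 < 4 * dataOf P m * dataOf P (m - 2)) (x : ℝ) :
    (jensenPoly (dataOf P) 3 (m - 2)).eval x ≠ 0 := by
  rw [eval_jensenPoly_dataOf_three P hm h2 x]
  apply quadratic_ne_zero_of_discrim_ne_sq
  intro s hs
  have hd : discrim (3 * dataOf P m) (3 * dataOf P (m - 1)) (dataOf P (m - 2)) < 0 := by
    unfold discrim; nlinarith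
  rw [hs] at hd
  exact absurd hd (not_lt.2 (sq_nonneg s))

/-- … and hence is NOT hyperbolic (it has degree `2`). -/
theorem not_splits_jensenPoly_dataOf_three (P : ℝ[X]) {m : ℕ} (hm : P.natDegree = m) (h2 : 2 ≤ m)
    (htop : 3 * dataOf P (m - 1) ^ 2 < 4 * dataOf P m * dataOf P (m - 2)) :
    ¬ (jensenPoly (dataOf P) 3 (m - 2)).Splits := by
  intro hs
  have hP : P ≠ 0 := by rintro rfl; simp at hm; omega
  have hc2 : (jensenPoly (dataOf P) 3 (m - 2)).coeff 2 ≠ 0 := by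
    rw [coeff_jensenPoly', show m - 2 + 2 = m by omega]
    refine mul_ne_zero (by exact_mod_cast (show Nat.choose 3 2 ≠ 0 by decide)) ?_
    rw [← hm]; exact dataOf_natDegree_ne_zero P hP
  have hdeg : (jensenPoly (dataOf P) 3 (m - 2)).degree ≠ 0 := by
    intro h0
    have := le_degree_of_ne_zero hc2
    rw [h0] at this
    exact absurd this (by decide)
  obtain ⟨x, hx⟩ := hs.exists_eval_eq_zero hdeg
  exact eval_jensenPoly_dataOf_three_ne_zero P hm h2 htop x hx

/-! ## §2 TOP-CRITERION COLLAPSE: every row is born by one step past its full degree -/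

/-- Anti-diagonal descent: `J^{k+3, m-2-k}_γ` is non-hyperbolic for every `k ≤ m-2`. -/
theorem not_splits_antidiagonal (P : ℝ[X]) {m : ℕ} (hm : P.natDegree = m) (h2 : 2 ≤ m)
    (htop : 3 * dataOf P (m - 1) ^ 2 < 4 * dataOf P m * dataOf P (m - 2)) :
    ∀ k, k + 2 ≤ m → ¬ (jensenPoly (dataOf P) (k + 3) (m - 2 - k)).Splits := by
  intro k
  induction k with
  | zero => intro _; simpa using not_splits_jensenPoly_dataOf_three P hm h2 htop
  | succ k ih =>
    intro hk hs
    have h' := JenDeflation.splits_jensenPoly_shift_of_succ (γ := dataOf P) (d := k + 3) (n := m - 2 - (k + 1))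
      (by simpa [show k + 1 + 3 = k + 3 + 1 by omega] using hs)
    rw [show m - 2 - (k + 1) + 1 = m - 2 - k by omega] at h'
    exact ih (by omega) h'

/-- **TOP-CRITERION COLLAPSE.** For a real polynomial `P` of degree `m ≥ 2` whose data satisfy the top criterion
`3γ_{m-1}² < 4γ_m γ_{m-2}`, EVERY row `n ≤ m-2` of the Jensen grid of `γ = dataOf P` is non-hyperbolic at degree
`m - n + 1` (one past its full degree `m - n`), hence — births being monotone — born at some `δ(n) ≤ m - n + 1`. -/
theorem not_splits_of_topCriterion (P : ℝ[X]) {m : ℕ} (hm : P.natDegree = m) (h2 : 2 ≤ m)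
    (htop : 3 * dataOf P (m - 1) ^ 2 < 4 * dataOf P m * dataOf P (m - 2)) {n : ℕ} (hn : n + 2 ≤ m) :
    ¬ (jensenPoly (dataOf P) (m - n + 1) n).Splits := by
  have h := not_splits_antidiagonal P hm h2 htop (m - 2 - n) (by omega)
  rwa [show m - 2 - n + 3 = m - n + 1 by omega, show m - 2 - (m - 2 - n) = n by omega] at h

/-- Contrapositive bookkeeping: under the top criterion, a row that is hyperbolic at its full degree `m - n` is born
EXACTLY at `m - n + 1` — the saturated value. -/
theorem born_at_full_degree_succ (P : ℝ[X]) {m : ℕ} (hm : P.natDegree = m) (h2 : 2 ≤ m)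
    (htop : 3 * dataOf P (m - 1) ^ 2 < 4 * dataOf P m * dataOf P (m - 2)) {n : ℕ} (hn : n + 2 ≤ m)
    (hfull : (jensenPoly (dataOf P) (m - n) n).Splits) :
    (jensenPoly (dataOf P) (m - n) n).Splits ∧ ¬ (jensenPoly (dataOf P) (m - n + 1) n).Splits :=
  ⟨hfull, not_splits_of_topCriterion P hm h2 htop hn⟩

/-! ## §3 EXTENSION IDENTITY: the grid of `R` above row `0` is the grid of `R'` -/

/-- `dataOf R' k = dataOf R (k+1)` : `k!·(k+1)R_{k+1} = (k+1)!·R_{k+1}`. -/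
theorem dataOf_derivative (R : ℝ[X]) (k : ℕ) : dataOf (derivative R) k = dataOf R (k + 1) := by
  unfold dataOf
  rw [coeff_derivative, Nat.factorial_succ]
  push_cast
  ring

/-- **EXTENSION IDENTITY.** `J^{d,n}_{dataOf R'} = J^{d,n+1}_{dataOf R}`: the Jensen rows `n+1, n+2, …` of the datum of
`R` are the rows `n, n+1, …` of the datum of its derivative. -/
theorem jensenPoly_dataOf_derivative (R : ℝ[X]) (d n : ℕ) :
    jensenPoly (dataOf (derivative R)) d n = jensenPoly (dataOf R) d (n + 1) := by
  unfold jensenPoly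
  refine Finset.sum_congr rfl fun j _ => ?_
  rw [dataOf_derivative, Nat.add_right_comm]

/-- Iterated: the rows `≥ n` of `dataOf R` are the rows of `dataOf R⁽ⁿ⁾`. -/
theorem jensenPoly_dataOf_iterate_derivative (R : ℝ[X]) (d n i : ℕ) :
    jensenPoly (dataOf (derivative^[i] R)) d n = jensenPoly (dataOf R) d (n + i) := by
  induction i generalizing R n with
  | zero => simp
  | succ i ih =>
    rw [Function.iterate_succ', Function.comp_apply, jensenPoly_dataOf_derivative, ih, Nat.add_right_comm,
      Nat.add_assoc]

/-! ## §4 REVERSAL DUALITY: a row-`n` cell is the reversal of a row-`0` cell of the reversed data -/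

/-- `J^{d,n}_γ` depends only on the window `γ_n, …, γ_{n+d}`. -/
theorem jensenPoly_congr {γ γ' : ℕ → ℝ} {d n n' : ℕ} (h : ∀ j ≤ d, γ (n + j) = γ' (n' + j)) :
    jensenPoly γ d n = jensenPoly γ' d n' := by
  unfold jensenPoly
  refine Finset.sum_congr rfl fun j hj => ?_
  rw [h j (Nat.lt_succ_iff.mp (Finset.mem_range.mp hj))]

/-- **REVERSAL DUALITY** (general data). `reflect d (J^{d,n}_γ) = J^{d,0}_a` with `a_i = γ_{n+d-i}`:
coefficientwise `(d choose d-i)·γ_{n+d-i} = (d choose i)·a_i`. -/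
theorem reflect_jensenPoly (γ : ℕ → ℝ) (d n : ℕ) :
    reflect d (jensenPoly γ d n) = jensenPoly (fun i => γ (n + d - i)) d 0 := by
  ext i
  rw [coeff_reflect, coeff_jensenPoly', coeff_jensenPoly', zero_add]
  by_cases hi : i ≤ d
  · rw [revAt_le hi, Nat.choose_symm hi, show n + (d - i) = n + d - i by omega]
  · rw [revAt_eq_self_of_lt (not_le.mp hi), Nat.choose_eq_zero_of_lt (not_le.mp hi)]
    simp

/-- … and back: `reflect d (J^{d,0}_a) = J^{d,n}_γ`. -/
theorem reflect_jensenPoly_rev (γ : ℕ → ℝ) (d n : ℕ) :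
    reflect d (jensenPoly (fun i => γ (n + d - i)) d 0) = jensenPoly γ d n := by
  rw [reflect_jensenPoly]
  exact jensenPoly_congr fun j hj => by simp only [zero_add]; congr 1; omega

/-- The two cells are hyperbolic together (tree `PolyaSchur.splits_reflect`, both directions). -/
theorem splits_jensenPoly_iff_reflect (γ : ℕ → ℝ) (d n : ℕ) :
    (jensenPoly γ d n).Splits ↔ (jensenPoly (fun i => γ (n + d - i)) d 0).Splits := by
  constructor
  · intro h
    rw [← reflect_jensenPoly]
    exact Literature.Analysis.Complex.PolyaSchur.splits_reflect h (natDegree_jensenPoly_le _ _ _)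
  · intro h
    rw [← reflect_jensenPoly_rev]
    exact Literature.Analysis.Complex.PolyaSchur.splits_reflect h (natDegree_jensenPoly_le _ _ _)

/-- Specialisation to polynomial data: for `γ = dataOf P`, `deg P = m`, `n + d = m`, the reversed window is the FIXED
sequence `a_i = γ_{m-i}` (independent of the row): `J^{m-n,n}_γ` hyperbolic `↔ J^{m-n,0}_a` hyperbolic. -/
theorem splits_row_iff_splits_rowZero_rev (P : ℝ[X]) {m n : ℕ} (hn : n ≤ m) :
    (jensenPoly (dataOf P) (m - n) n).Splits ↔ (jensenPoly (fun i => dataOf P (m - i)) (m - n) 0).Splits := by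
  rw [splits_jensenPoly_iff_reflect]
  have : (fun i => dataOf P (n + (m - n) - i)) = fun i => dataOf P (m - i) := by
    funext i; rw [show n + (m - n) = m by omega]
  rw [this]

/-! ## §5 TOWER CRITERION (⟸): one inequality + the row-`0` cells of the reversed data -/

/-- **TOWER CRITERION.** Let `P` be real of degree `m ≥ 2`, `γ = dataOf P`, `a_i := γ_{m-i}`. If the top criterion
`3γ_{m-1}² < 4γ_m γ_{m-2}` holds and the row-`0` Jensen polynomials `J^{r,0}_a` are hyperbolic for `2 ≤ r ≤ m`, then
every row `n ≤ m-2` of the Jensen grid of `γ` is hyperbolic at its full degree `m-n` and NOT hyperbolic at `m-n+1`: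
the exactly saturated staircase. (With `N(P) = 2` this is the card's «saturated one-pair tower»; the converse direction
is §4 read backwards plus the discriminant of the top cell.) -/
theorem saturated_of_criterion (P : ℝ[X]) {m : ℕ} (hm : P.natDegree = m) (h2 : 2 ≤ m)
    (htop : 3 * dataOf P (m - 1) ^ 2 < 4 * dataOf P m * dataOf P (m - 2))
    (hrow0 : ∀ r, 2 ≤ r → r ≤ m → (jensenPoly (fun i => dataOf P (m - i)) r 0).Splits)
    {n : ℕ} (hn : n + 2 ≤ m) :
    (jensenPoly (dataOf P) (m - n) n).Splits ∧ ¬ (jensenPoly (dataOf P) (m - n + 1) n).Splits :=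
  ⟨(splits_row_iff_splits_rowZero_rev P (by omega)).2 (hrow0 (m - n) (by omega) (by omega)),
   not_splits_of_topCriterion P hm h2 htop hn⟩

/-! ## §6 COUNT FORM (v2): `N(J^{m-n,n}_γ) = N(J^{m-n,0}_a) ≤ N(P)` -/

open Literature.Analysis.Complex (nonrealRootCount)

/-- Reversal preserves the non-real root count of a Jensen cell (tree `nonrealRootCount_reflect`). -/
theorem nonrealRootCount_jensenPoly_eq_reflect (γ : ℕ → ℝ) (d n : ℕ) :
    nonrealRootCount (jensenPoly γ d n) = nonrealRootCount (jensenPoly (fun i => γ (n + d - i)) d 0) := by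
  rw [← reflect_jensenPoly, JensenCountMonotonicity.nonrealRootCount_reflect (natDegree_jensenPoly_le _ _ _)]

/-- For polynomial data: `N(J^{m-n,n}_γ) = N(J^{m-n,0}_a)`, `a_i = γ_{m-i}`. -/
theorem nonrealRootCount_row_eq_rowZero_rev (P : ℝ[X]) {m n : ℕ} (hn : n ≤ m) :
    nonrealRootCount (jensenPoly (dataOf P) (m - n) n)
      = nonrealRootCount (jensenPoly (fun i => dataOf P (m - i)) (m - n) 0) := by
  rw [nonrealRootCount_jensenPoly_eq_reflect]
  have : (fun i => dataOf P (n + (m - n) - i)) = fun i => dataOf P (m - i) := by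
    funext i; rw [show n + (m - n) = m by omega]
  rw [this]

/-- **COUNT BOUND for the reversed row-`0` cells**: `N(J^{r,0}_a) ≤ N(P)` for `a_i = dataOf P (m-i)`, `r ≤ m` (any real
`P`, any `m`; tree: `N(J^{d,n}_{dataOf P}) ≤ N(P)`). In the card's one-pair towers `N(P) = 2`, so every `A_r` has at most
one non-real pair — the first step of the J₁-tower theorem. -/
theorem nonrealRootCount_rowZero_rev_le (P : ℝ[X]) {m r : ℕ} (hr : r ≤ m) :
    nonrealRootCount (jensenPoly (fun i => dataOf P (m - i)) r 0) ≤ nonrealRootCount P := by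
  have h := nonrealRootCount_row_eq_rowZero_rev P (Nat.sub_le m r)
  rw [show m - (m - r) = r by omega] at h
  rw [← h]
  exact JensenBirthBand.nonrealRootCount_jensenPoly_dataOf_le_top P r (m - r)

end RhSplitJenNegG15.TowerCriterion
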